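import Literature.Geometry.Lorentzian.KerrSchildWaveCauchyProblem
import HarnessLib

/-!
# The `3 + 1` form of a generalised Kerr–Schild background over `ℝ⁴`: lapse, shift and slice
# metric as functions of the inverse metric; uniform bounds (family `gr`; infrastructure for the
# discharge of the named fact `KerrSchild.waveCauchyProblem`)

For a generalised Kerr–Schild background `B` on `ℝ⁴` (`KerrSchild.Background`:
`g⁻¹ = η⁻¹ − φ ℓ♯ ⊗ ℓ♯`, `0 ≤ φ ≤ Φ`, `ℓ` null with `ℓ(∂_t) = 1` wherever `φ ≠ 0`) the `3 + 1`
splitting of `g = η + φ ℓ ⊗ ℓ` with respect to the slices `{t = const}`,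
`g = −N² dt² + (g_t)_{ij} (dxⁱ + βⁱ dt)(dxʲ + βʲ dt)`, has
(Choquet-Bruhat–Cotsakis 2002, §2, (2.1) and hypotheses (2.2)–(2.4), as verified for this class in
the module docstring of `KerrSchildWaveCauchyProblem.lean`)

* `N⁻² = −g^{00} = 1 + φ` (`Background.invLapseSq`), so `1 ≤ N⁻² ≤ 1 + Φ`;
* `βⁱ = −g^{0i}/g^{00} = g^{0i}/(1 + φ)` (`Background.shift`), equal to `φ ℓⁱ/(1 + φ)` where
  `φ ≠ 0` and to `0` where `φ = 0`, with `|β|² = (φ/(1 + φ))² ≤ (Φ/(1 + Φ))² < 1`;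
* inverse slice metric `(g_t)^{ij} = g^{ij} − g^{0i} g^{0j}/g^{00} = g^{ij} + (1 + φ) βⁱ βʲ`
  (`Background.sliceInvMetric`), equal to `δ^{ij} − (φ/(1 + φ)) ℓⁱ ℓʲ`, with
  `|ξ|²/(1 + φ) ≤ (g_t)^{ij} ξ_i ξ_j ≤ |ξ|²`;
* slice metric `(g_t)_{ij} = δ_{ij} + φ ℓ_i ℓ_j = 2δ_{ij} − g^{ij}` (`Background.sliceMetric`), the
  inverse of `(g_t)^{ij}` (`sum_sliceInvMetric_mul_sliceMetric`), with
  `|v|² ≤ (g_t)_{ij} vⁱ vʲ ≤ (1 + Φ)|v|²` (hypothesis (2.3) with `A = 1`).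

Everything is expressed through the smooth components `g^{μν}` (`B.contDiff_inverseMetric`) and
`1 + φ = −g^{00}`, never through `ℓ` alone (which a `Background` leaves unconstrained where
`φ = 0`), so that all four objects are `C^∞` on `ℝ⁴`. Everything below is proved; no named facts.

## Why this file exists: the discharge plan for `KerrSchild.waveCauchyProblem` (review, D-0026)

`KerrSchild.waveCauchyProblem` (Bär–Ginoux–Pfäffle 2007, Thm. 3.2.11 with Choquet-Bruhat–Cotsakis
2002, Thm. 2.1) is to be proved — not split further — by the energy method for the **first-order
symmetric-hyperbolic form** of `□_G u = ∑_μ ∂_μ (g^{μν} ∂_ν u) = 0` in the lapse–shift variables of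
this file, following Alinhac, *Hyperbolic PDE* (2009), §7.6, Thm. 7.11 (existence of smooth
solutions of symmetric hyperbolic systems by an `ε`-regularised ODE in a space of functions of `x`,
energy estimates uniform in `ε`, Sobolev's lemma and a limit) and John, *PDE* (1982), Ch. 5, §3,
(3.2)–(3.4) (reduction of a second-order hyperbolic equation to a symmetric hyperbolic system).
Two features of Kerr–Schild backgrounds dictate the variables. (1) Where `φ ≥ 1` (e.g. near the
horizon of extremal Kerr in the chart `Kerr.region M r₀`, `r₀ < M`) the field `∂_t` is not timelike
and `(g^{ij}) = δ − φ ℓ⃗ ⊗ ℓ⃗` is not positive definite, so John's reduction with `q₀ = ∂_t u`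
(whose `A⁰ = diag(−g^{00}, g^{ij})`) and every `∂_t`-multiplier energy fail there; only the slices
are spacelike and `dt` timelike. (2) With `a := 1 + φ = N⁻²`, `q₀ := ∂_t u − βᵏ ∂_k u`,
`q_k := ∂_k u` one has the pointwise identity
`g^{μν} ∂_μ∂_ν u = −a (∂_t − βʲ∂_j) q₀ + (g_t)^{jk} ∂_j q_k − a (∂_t βᵏ − βʲ ∂_j βᵏ) q_k`,
so `□_G u = 0` becomes the system for `V = (q₀, q₁, q₂, q₃, u)`
`a ∂_t q₀ = a βʲ ∂_j q₀ + (g_t)^{jk} ∂_j q_k + (order 0)`,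
`(g_t)^{ij} ∂_t q_j = (g_t)^{ij} ∂_j q₀ + (g_t)^{ij} βᵏ ∂_k q_j + (g_t)^{ij} (∂_j βᵏ) q_k`,
`∂_t u = q₀ + βᵏ q_k`, i.e. `A⁰ ∂_t V = Aᵏ ∂_k V + B V` with `A⁰ = diag(a, (g_t)^{ij}, 1)`
**uniformly positive definite by the bounds of this file** and `Aᵏ` symmetric; the constraint
`q⃗ = ∇u` propagates because `ω_{kj} = ∂_k q_j − ∂_j q_k` solves the closed transport system
`∂_t ω_{kj} = βᵐ ∂_m ω_{kj} + (∂_k βᵐ) ω_{mj} + (∂_j βᵐ) ω_{km}` with `|β| < 1`, and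
`∂_t (q_j − ∂_j u) = βᵏ ω_{kj}`. The regularisation is Alinhac's, with the mollifier placed
symmetrically, `∂_t V = (A⁰)⁻¹ χ J_ε (Aᵏ∂_k + B) J_ε (χ V)` (`χ` a spatial cut-off, `J_ε` an even
mollifier), for which `d/dt ⟨A⁰V, V⟩ = 2⟨(Aᵏ∂_k + B) W, W⟩ + ⟨(∂_t A⁰) V, V⟩`, `W = J_ε(χ V)`,
holds exactly, so that no commutator lemma is needed; finite speed of propagation, uniqueness and
the passage from slabs to `ℝ⁴` use the proved energy files of this directory
(`KerrSchild.Background.lintegral_energy_estimate`, `KerrSchild.Background.fderiv_eq_zero_of_weight`,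
`Kerr.coneFactor_flux`), and the generic analysis the tree's `Literature/Analysis/ODE/LinearGrowth`,
`FunctionSpaces/Mollification`, `FunctionSpaces/SobolevImbeddingSup`,
`FunctionSpaces/SmoothUniformLimit`, `Calculus/JointSmoothnessPartials`.

## References

* Y. Choquet-Bruhat, S. Cotsakis, *Global hyperbolicity and completeness*, J. Geom. Phys. 43
  (2002) 345–350 (arXiv:gr-qc/0201057), §2 (key `ChoquetbruhatCotsakis2002`).
* R. P. Kerr, A. Schild, 1965, §2 (key `KerrSchild1965`).
* S. Alinhac, *Hyperbolic partial differential equations*, Springer 2009, §7.6, Thm. 7.11 and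
  Lemma 7.12 (key `AlinhacHPDE2009`).
* F. John, *Partial differential equations*, 4th ed., Springer 1982, Ch. 5, §3, (3.2)–(3.4)
  (key `John1982`).
-/

noncomputable section

open Set Filter
open scoped ContDiff Topology

namespace Literature.Geometry.Lorentzian

namespace KerrSchild

/-! ### Two algebraic identities for rank-one perturbations of the identity on `ℝ³` -/

/-- `∑_{jk} (δ_{jk} − c p_j p_k) ξ_j ξ_k = |ξ|² − c (p·ξ)²`. [folklore] -/
theorem sum_sum_kronecker_sub_rankOne_mul_mul (c : ℝ) (p ξ : Fin 3 → ℝ) :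
    ∑ j : Fin 3, ∑ k : Fin 3, ((if j = k then (1 : ℝ) else 0) - c * p j * p k) * ξ j * ξ k =
      ∑ k : Fin 3, ξ k ^ 2 - c * (∑ k : Fin 3, p k * ξ k) ^ 2 := by
  simp only [Fin.sum_univ_three, Fin.isValue, show (0 : Fin 3) ≠ 1 from by decide,
    show (0 : Fin 3) ≠ 2 from by decide, show (1 : Fin 3) ≠ 0 from by decide,
    show (1 : Fin 3) ≠ 2 from by decide, show (2 : Fin 3) ≠ 0 from by decide,
    show (2 : Fin 3) ≠ 1 from by decide, if_true, if_false]
  ring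

/-- `(δ − c p pᵀ)(δ + f p pᵀ) = δ` when `|p|² = 1` and `c (1 + f) = f`. [folklore] -/
theorem sum_kronecker_sub_rankOne_mul_kronecker_add_rankOne {f c : ℝ} {p : Fin 3 → ℝ}
    (hc : c * (1 + f) = f) (hS : ∑ k : Fin 3, p k ^ 2 = 1) (j l : Fin 3) :
    ∑ k : Fin 3, ((if j = k then (1 : ℝ) else 0) - c * p j * p k) *
        ((if k = l then (1 : ℝ) else 0) + f * p k * p l) = if j = l then 1 else 0 := by
  have h1 : ∀ k : Fin 3, ((if j = k then (1 : ℝ) else 0) - c * p j * p k) *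
      ((if k = l then (1 : ℝ) else 0) + f * p k * p l) =
        (if j = k then ((if k = l then (1 : ℝ) else 0) + f * p k * p l) else 0) -
          (if k = l then c * p j * p k else 0) - c * f * p j * p l * p k ^ 2 := by
    intro k
    split_ifs <;> ring
  rw [Finset.sum_congr rfl fun k _ ↦ h1 k, Finset.sum_sub_distrib, Finset.sum_sub_distrib,
    Finset.sum_ite_eq, Finset.sum_ite_eq', ← Finset.mul_sum, hS]
  simp only [Finset.mem_univ, if_true]
  split_ifs <;> linear_combination (-(p j * p l)) * hc

namespace Background

variable (B : Background)

/-! ### The null vector where the profile is nonzero -/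

/-- Where `φ ≠ 0`: `l⁰ = −1` (the normalisation `η(l, ∂_t) = 1`). [cite: KerrSchild1965, §2] -/
theorem l_zero_eq {x : E4} (hx : B.φ x ≠ 0) : B.l x 0 = -1 := by
  have h := B.normalised x hx
  rw [Minkowski.bilin_symm, Minkowski.bilin_basisVector_zero_left] at h
  linarith

/-- Where `φ ≠ 0`: `|ℓ⃗|² = ∑ᵢ (lⁱ)² = 1` (`η(l, l) = 0` and `l⁰ = −1`). [cite: KerrSchild1965, §2] -/
theorem sum_sq_l_succ {x : E4} (hx : B.φ x ≠ 0) : ∑ k : Fin 3, B.l x k.succ ^ 2 = 1 := by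
  have h := B.null x hx
  rw [Minkowski.bilin_apply, B.l_zero_eq hx] at h
  have : ∑ k : Fin 3, B.l x k.succ ^ 2 = ∑ k : Fin 3, B.l x k.succ * B.l x k.succ :=
    Finset.sum_congr rfl fun k _ ↦ sq _
  rw [this]
  linarith

/-- Where `φ ≠ 0`: `|lⁱ| ≤ 1` for the spatial components (`|ℓ⃗| = 1`). [cite: KerrSchild1965, §2] -/
theorem abs_l_succ_le_one {x : E4} (hx : B.φ x ≠ 0) (k : Fin 3) : |B.l x k.succ| ≤ 1 := by
  have hS := B.sum_sq_l_succ hx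
  have hk : B.l x k.succ ^ 2 ≤ ∑ j : Fin 3, B.l x j.succ ^ 2 :=
    Finset.single_le_sum (fun j _ ↦ sq_nonneg (B.l x j.succ)) (Finset.mem_univ k)
  rw [hS] at hk
  exact abs_le_one_iff_mul_self_le_one.mpr (by nlinarith)

/-- Where `φ ≠ 0`: `g^{0i} = φ lⁱ` (spatial `i`; `η^{0i} = 0`, `l⁰ = −1`). [cite: KerrSchild1965, §2] -/
theorem inverseMetric_zero_succ_of_ne_zero {x : E4} (hx : B.φ x ≠ 0) (k : Fin 3) :
    B.inverseMetric x 0 k.succ = B.φ x * B.l x k.succ := by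
  show KerrSchild.inverseMetric B.φ B.l x 0 k.succ = _
  simp only [KerrSchild.inverseMetric, Kerr.etaComp, if_neg (Fin.succ_ne_zero k).symm,
    B.l_zero_eq hx]
  ring

/-- Where `φ = 0`: `g^{0i} = 0` (spatial `i`). [cite: KerrSchild1965, §2] -/
theorem inverseMetric_zero_succ_of_eq_zero {x : E4} (hx : B.φ x = 0) (k : Fin 3) :
    B.inverseMetric x 0 k.succ = 0 := by
  show KerrSchild.inverseMetric B.φ B.l x 0 k.succ = _
  simp only [KerrSchild.inverseMetric, Kerr.etaComp, if_neg (Fin.succ_ne_zero k).symm, hx]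
  ring

/-- The spatial components: `g^{ij} = δ^{ij} − φ lⁱ lʲ`. [cite: KerrSchild1965, §2] -/
theorem inverseMetric_succ_succ (x : E4) (j k : Fin 3) :
    B.inverseMetric x j.succ k.succ =
      (if j = k then 1 else 0) - B.φ x * B.l x j.succ * B.l x k.succ := by
  show KerrSchild.inverseMetric B.φ B.l x j.succ k.succ = _
  simp [KerrSchild.inverseMetric, Kerr.etaComp, Fin.succ_ne_zero]

/-! ### The inverse square lapse `N⁻² = 1 + φ = −g^{00}` -/

/-- The **inverse square lapse** `N⁻² = 1 + φ` of the `3 + 1` form of `g = η + φ ℓ ⊗ ℓ`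
(`N = (1 + φ)^{-1/2}`; Choquet-Bruhat–Cotsakis 2002, §2, (2.1)–(2.2)).
[cite: ChoquetbruhatCotsakis2002, §2 (2.2)] -/
def invLapseSq (x : E4) : ℝ := 1 + B.φ x

/-- Unfolding. [cite: ChoquetbruhatCotsakis2002, §2 (2.2)] -/
theorem invLapseSq_apply (x : E4) : B.invLapseSq x = 1 + B.φ x := rfl

/-- `N⁻² = −g^{00}`. [cite: ChoquetbruhatCotsakis2002, §2 (2.2)] -/
theorem invLapseSq_eq_neg_inverseMetric (x : E4) : B.invLapseSq x = -B.inverseMetric x 0 0 := by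
  rw [B.inverseMetric_zero_zero x, invLapseSq]; ring

/-- `1 ≤ N⁻²` (`φ ≥ 0`): the lapse is bounded above by `1`. [cite: ChoquetbruhatCotsakis2002, §2 (2.2)] -/
theorem one_le_invLapseSq (x : E4) : 1 ≤ B.invLapseSq x := by
  rw [invLapseSq]; linarith [B.φ_nonneg x]

/-- `0 < N⁻²`. [cite: ChoquetbruhatCotsakis2002, §2 (2.2)] -/
theorem invLapseSq_pos (x : E4) : 0 < B.invLapseSq x :=
  lt_of_lt_of_le one_pos (B.one_le_invLapseSq x)

/-- `N⁻² ≤ 1 + Φ`: the lapse is bounded below by `(1 + Φ)^{-1/2}`.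
[cite: ChoquetbruhatCotsakis2002, §2 (2.2)] -/
theorem invLapseSq_le (x : E4) : B.invLapseSq x ≤ 1 + B.bound := by
  rw [invLapseSq]; linarith [B.φ_le x]

/-- `N⁻²` is smooth. [cite: ChoquetbruhatCotsakis2002, §2] -/
theorem contDiff_invLapseSq : ContDiff ℝ ∞ B.invLapseSq :=
  contDiff_const.add B.contDiff_φ

/-- `N² = (1 + φ)⁻¹` is smooth (`1 + φ ≥ 1`). [cite: ChoquetbruhatCotsakis2002, §2] -/
theorem contDiff_inv_invLapseSq : ContDiff ℝ ∞ fun x ↦ (B.invLapseSq x)⁻¹ :=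
  B.contDiff_invLapseSq.inv fun x ↦ (B.invLapseSq_pos x).ne'

/-! ### The shift `βⁱ = g^{0i}/(1 + φ)` -/

/-- The **shift** `βⁱ = −g^{0i}/g^{00} = g^{0i}/(1 + φ)` of the `3 + 1` form of
`g = η + φ ℓ ⊗ ℓ` (`= φ ℓⁱ/(1 + φ)` where `φ ≠ 0`); Choquet-Bruhat–Cotsakis 2002, §2, (2.1), (2.4).
[cite: ChoquetbruhatCotsakis2002, §2 (2.4)] -/
def shift (x : E4) (k : Fin 3) : ℝ := B.inverseMetric x 0 k.succ / B.invLapseSq x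

/-- `(1 + φ) βⁱ = g^{0i}`. [cite: ChoquetbruhatCotsakis2002, §2 (2.1)] -/
theorem invLapseSq_mul_shift (x : E4) (k : Fin 3) :
    B.invLapseSq x * B.shift x k = B.inverseMetric x 0 k.succ := by
  rw [shift, mul_div_cancel₀ _ (B.invLapseSq_pos x).ne']

/-- Where `φ ≠ 0`: `βⁱ = φ lⁱ/(1 + φ)`. [cite: ChoquetbruhatCotsakis2002, §2 (2.1)] -/
theorem shift_eq_of_ne_zero {x : E4} (hx : B.φ x ≠ 0) (k : Fin 3) :
    B.shift x k = B.φ x * B.l x k.succ / (1 + B.φ x) := by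
  rw [shift, B.inverseMetric_zero_succ_of_ne_zero hx, invLapseSq]

/-- Where `φ = 0`: `β = 0`. [cite: ChoquetbruhatCotsakis2002, §2 (2.1)] -/
theorem shift_eq_zero_of_eq_zero {x : E4} (hx : B.φ x = 0) (k : Fin 3) : B.shift x k = 0 := by
  rw [shift, B.inverseMetric_zero_succ_of_eq_zero hx, zero_div]

/-- **`βⁱ = (φ/(1 + φ)) lⁱ` everywhere** (where `φ = 0` both sides vanish, whatever `l` is).
[cite: ChoquetbruhatCotsakis2002, §2 (2.1)] -/
theorem shift_eq (x : E4) (k : Fin 3) : B.shift x k = B.φ x / (1 + B.φ x) * B.l x k.succ := by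
  by_cases hx : B.φ x = 0
  · rw [B.shift_eq_zero_of_eq_zero hx, hx]; ring
  · rw [B.shift_eq_of_ne_zero hx]; ring

/-- **`|β|² = (φ/(1 + φ))²`** (Euclidean square length of the coordinate shift; its `g_t`-length is
`φ/(1 + φ)^{1/2} ≤ Φ^{1/2}`, hypothesis (2.4)). [cite: ChoquetbruhatCotsakis2002, §2 (2.4)] -/
theorem sum_shift_sq (x : E4) : ∑ k : Fin 3, B.shift x k ^ 2 = (B.φ x / (1 + B.φ x)) ^ 2 := by
  by_cases hx : B.φ x = 0
  · simp [B.shift_eq_zero_of_eq_zero hx, hx]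
  · have h1 := B.sum_sq_l_succ hx
    simp_rw [B.shift_eq x, mul_pow, ← Finset.mul_sum, h1, mul_one]

/-- `|β|² ≤ (Φ/(1 + Φ))²`. [cite: ChoquetbruhatCotsakis2002, §2 (2.4)] -/
theorem sum_shift_sq_le (x : E4) :
    ∑ k : Fin 3, B.shift x k ^ 2 ≤ (B.bound / (1 + B.bound)) ^ 2 := by
  rw [B.sum_shift_sq x]
  have h0 : 0 ≤ B.φ x := B.φ_nonneg x
  have h1 : B.φ x ≤ B.bound := B.φ_le x
  have hq : B.φ x / (1 + B.φ x) ≤ B.bound / (1 + B.bound) := by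
    rw [div_le_div_iff₀ (by linarith) (by linarith)]
    nlinarith
  exact pow_le_pow_left₀ (div_nonneg h0 (by linarith)) hq 2

/-- **`|β|² < 1`**: the slicing moves subluminally for `η`, uniformly (`|β| ≤ Φ/(1 + Φ)`).
[cite: ChoquetbruhatCotsakis2002, §2 (2.4)] -/
theorem sum_shift_sq_lt_one (x : E4) : ∑ k : Fin 3, B.shift x k ^ 2 < 1 := by
  refine (B.sum_shift_sq_le x).trans_lt ?_
  have hΦ : 0 ≤ B.bound := (B.φ_nonneg x).trans (B.φ_le x)
  have hq : B.bound / (1 + B.bound) < 1 := by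
    rw [div_lt_one (by linarith)]; linarith
  have hq0 : 0 ≤ B.bound / (1 + B.bound) := div_nonneg hΦ (by linarith)
  nlinarith

/-- Each shift component is bounded by `1` in absolute value. [cite: ChoquetbruhatCotsakis2002, §2 (2.4)] -/
theorem abs_shift_le_one (x : E4) (k : Fin 3) : |B.shift x k| ≤ 1 := by
  have h := B.sum_shift_sq_lt_one x
  have hk : B.shift x k ^ 2 ≤ ∑ j : Fin 3, B.shift x j ^ 2 :=
    Finset.single_le_sum (fun j _ ↦ sq_nonneg (B.shift x j)) (Finset.mem_univ k)
  exact abs_le_one_iff_mul_self_le_one.mpr (by nlinarith)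

/-- The shift is smooth (a quotient of smooth components by `1 + φ ≥ 1`).
[cite: ChoquetbruhatCotsakis2002, §2] -/
theorem contDiff_shift (k : Fin 3) : ContDiff ℝ ∞ fun x ↦ B.shift x k :=
  (B.contDiff_inverseMetric 0 k.succ).div B.contDiff_invLapseSq fun x ↦ (B.invLapseSq_pos x).ne'

/-! ### The inverse slice metric `(g_t)^{ij} = g^{ij} + (1 + φ) βⁱ βʲ` -/

/-- The **inverse slice metric** `(g_t)^{ij} = g^{ij} − g^{0i} g^{0j}/g^{00} = g^{ij} + (1 + φ) βⁱ βʲ`,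
the inverse of the metric `g_t = δ + φ ℓ⃗ ⊗ ℓ⃗` induced on the slices `{t = const}` (the spatial
block of `g⁻¹` in the `3 + 1` form (2.1) is `g^{ij} = (g_t)^{ij} − βⁱβʲ/N²`).
[cite: ChoquetbruhatCotsakis2002, §2 (2.1), (2.3)] -/
def sliceInvMetric (x : E4) (j k : Fin 3) : ℝ :=
  B.inverseMetric x j.succ k.succ + B.invLapseSq x * B.shift x j * B.shift x k

/-- `(g_t)^{ij}` is symmetric. [cite: ChoquetbruhatCotsakis2002, §2 (2.1)] -/
theorem sliceInvMetric_symm (x : E4) (j k : Fin 3) :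
    B.sliceInvMetric x j k = B.sliceInvMetric x k j := by
  rw [sliceInvMetric, sliceInvMetric, show B.inverseMetric x j.succ k.succ =
    B.inverseMetric x k.succ j.succ from KerrSchild.inverseMetric_symm _ _ x _ _]
  ring

/-- **`(g_t)^{ij} = δ^{ij} − (φ/(1 + φ)) lⁱ lʲ` everywhere** (where `φ = 0` both sides are `δ`).
[cite: ChoquetbruhatCotsakis2002, §2 (2.1)] -/
theorem sliceInvMetric_eq (x : E4) (j k : Fin 3) :
    B.sliceInvMetric x j k =
      (if j = k then 1 else 0) - B.φ x / (1 + B.φ x) * B.l x j.succ * B.l x k.succ := by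
  have ha : (1 + B.φ x) ≠ 0 := by linarith [B.φ_nonneg x]
  rw [sliceInvMetric, B.inverseMetric_succ_succ, B.shift_eq, B.shift_eq, invLapseSq]
  field_simp
  ring

/-- The inverse slice metric as a quadratic form: `(g_t)^{ij} ξ_i ξ_j = |ξ|² − (φ/(1 + φ)) (ℓ⃗·ξ)²`.
[cite: ChoquetbruhatCotsakis2002, §2 (2.3)] -/
theorem sum_sum_sliceInvMetric_mul_mul (x : E4) (ξ : Fin 3 → ℝ) :
    ∑ j : Fin 3, ∑ k : Fin 3, B.sliceInvMetric x j k * ξ j * ξ k =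
      ∑ k : Fin 3, ξ k ^ 2 - B.φ x / (1 + B.φ x) * (∑ k : Fin 3, B.l x k.succ * ξ k) ^ 2 := by
  simp only [B.sliceInvMetric_eq]
  exact sum_sum_kronecker_sub_rankOne_mul_mul _ (fun k ↦ B.l x k.succ) ξ

/-- **Uniform ellipticity of the inverse slice metric, lower bound**:
`|ξ|²/(1 + φ) ≤ (g_t)^{ij} ξ_i ξ_j` (Cauchy–Schwarz `(ℓ⃗·ξ)² ≤ |ξ|²` with `|ℓ⃗| = 1`: the
eigenvalues are `1, 1, 1/(1 + φ)`). [cite: ChoquetbruhatCotsakis2002, §2 (2.3)] -/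
theorem sum_sliceInvMetric_mul_mul_ge (x : E4) (ξ : Fin 3 → ℝ) :
    (∑ k : Fin 3, ξ k ^ 2) / (1 + B.φ x) ≤
      ∑ j : Fin 3, ∑ k : Fin 3, B.sliceInvMetric x j k * ξ j * ξ k := by
  have h0 : 0 ≤ B.φ x := B.φ_nonneg x
  have ha : 0 < 1 + B.φ x := by linarith
  have hξ : 0 ≤ ∑ k : Fin 3, ξ k ^ 2 := Finset.sum_nonneg fun k _ ↦ sq_nonneg _
  rw [B.sum_sum_sliceInvMetric_mul_mul]
  by_cases hx : B.φ x = 0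
  · rw [hx, zero_div, zero_mul, sub_zero, add_zero, div_one]
  · -- Cauchy–Schwarz with `|ℓ⃗|² = 1`
    have hcs : (∑ k : Fin 3, B.l x k.succ * ξ k) ^ 2 ≤ ∑ k : Fin 3, ξ k ^ 2 := by
      have h := Finset.sum_mul_sq_le_sq_mul_sq Finset.univ (fun k : Fin 3 ↦ B.l x k.succ) ξ
      rwa [B.sum_sq_l_succ hx, one_mul] at h
    have hq : 0 ≤ B.φ x / (1 + B.φ x) := div_nonneg h0 ha.le
    have hkey : (∑ k : Fin 3, ξ k ^ 2) / (1 + B.φ x) =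
        ∑ k : Fin 3, ξ k ^ 2 - B.φ x / (1 + B.φ x) * ∑ k : Fin 3, ξ k ^ 2 := by
      field_simp
      ring
    rw [hkey]
    nlinarith [mul_le_mul_of_nonneg_left hcs hq]

/-- **Uniform ellipticity, lower bound with the profile bound**: `|ξ|²/(1 + Φ) ≤ (g_t)^{ij} ξ_i ξ_j`.
[cite: ChoquetbruhatCotsakis2002, §2 (2.3)] -/
theorem sum_sliceInvMetric_mul_mul_ge' (x : E4) (ξ : Fin 3 → ℝ) :
    (∑ k : Fin 3, ξ k ^ 2) / (1 + B.bound) ≤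
      ∑ j : Fin 3, ∑ k : Fin 3, B.sliceInvMetric x j k * ξ j * ξ k := by
  refine le_trans ?_ (B.sum_sliceInvMetric_mul_mul_ge x ξ)
  have h0 : 0 ≤ B.φ x := B.φ_nonneg x
  exact div_le_div_of_nonneg_left (Finset.sum_nonneg fun k _ ↦ sq_nonneg _) (by linarith)
    (by linarith [B.φ_le x])

/-- **Upper bound**: `(g_t)^{ij} ξ_i ξ_j ≤ |ξ|²` (`φ ≥ 0`). [cite: ChoquetbruhatCotsakis2002, §2 (2.3)] -/
theorem sum_sliceInvMetric_mul_mul_le (x : E4) (ξ : Fin 3 → ℝ) :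
    ∑ j : Fin 3, ∑ k : Fin 3, B.sliceInvMetric x j k * ξ j * ξ k ≤ ∑ k : Fin 3, ξ k ^ 2 := by
  have h0 : 0 ≤ B.φ x := B.φ_nonneg x
  have hq : 0 ≤ B.φ x / (1 + B.φ x) := div_nonneg h0 (by linarith)
  rw [B.sum_sum_sliceInvMetric_mul_mul]
  nlinarith [sq_nonneg (∑ k : Fin 3, B.l x k.succ * ξ k)]

/-- In particular the diagonal entries satisfy `(g_t)^{ii} ≤ 1` (`= 1 − (φ/(1 + φ)) (lⁱ)²`).
[cite: ChoquetbruhatCotsakis2002, §2 (2.3)] -/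
theorem sliceInvMetric_self_le_one (x : E4) (j : Fin 3) : B.sliceInvMetric x j j ≤ 1 := by
  rw [B.sliceInvMetric_eq, if_pos rfl]
  have hq : 0 ≤ B.φ x / (1 + B.φ x) := div_nonneg (B.φ_nonneg x) (by linarith [B.φ_nonneg x])
  nlinarith [mul_nonneg hq (mul_self_nonneg (B.l x j.succ))]

/-- All entries are bounded, `|(g_t)^{ij}| ≤ 2` (from the closed form: `|lⁱ lʲ| ≤ 1` and
`φ/(1 + φ) ≤ 1`). [cite: ChoquetbruhatCotsakis2002, §2 (2.3)] -/
theorem abs_sliceInvMetric_le (x : E4) (j k : Fin 3) : |B.sliceInvMetric x j k| ≤ 2 := by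
  rw [B.sliceInvMetric_eq]
  have h0 : 0 ≤ B.φ x := B.φ_nonneg x
  have hq0 : 0 ≤ B.φ x / (1 + B.φ x) := div_nonneg h0 (by linarith)
  have hq1 : B.φ x / (1 + B.φ x) ≤ 1 := by rw [div_le_one (by linarith)]; linarith
  by_cases hx : B.φ x = 0
  · rw [hx, zero_div, zero_mul, zero_mul, sub_zero]
    split_ifs <;> simp
  · have hl : ∀ i : Fin 3, |B.l x i.succ| ≤ 1 := fun i ↦ B.abs_l_succ_le_one hx i
    have hprod : |B.φ x / (1 + B.φ x) * B.l x j.succ * B.l x k.succ| ≤ 1 := by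
      rw [abs_mul, abs_mul, abs_of_nonneg hq0]
      calc B.φ x / (1 + B.φ x) * |B.l x j.succ| * |B.l x k.succ| ≤ 1 * 1 * 1 := by
            gcongr
            · exact hl j
            · exact hl k
        _ = 1 := by ring
    have hδ : |(if j = k then (1 : ℝ) else 0)| ≤ 1 := by split_ifs <;> simp
    calc |(if j = k then (1 : ℝ) else 0) - B.φ x / (1 + B.φ x) * B.l x j.succ * B.l x k.succ|
        ≤ |(if j = k then (1 : ℝ) else 0)| + |B.φ x / (1 + B.φ x) * B.l x j.succ * B.l x k.succ| :=
          abs_sub _ _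
      _ ≤ 1 + 1 := add_le_add hδ hprod
      _ = 2 := by norm_num

/-- The inverse slice metric is smooth. [cite: ChoquetbruhatCotsakis2002, §2] -/
theorem contDiff_sliceInvMetric (j k : Fin 3) : ContDiff ℝ ∞ fun x ↦ B.sliceInvMetric x j k :=
  (B.contDiff_inverseMetric j.succ k.succ).add
    ((B.contDiff_invLapseSq.mul (B.contDiff_shift j)).mul (B.contDiff_shift k))

/-! ### The slice metric `(g_t)_{ij} = δ_{ij} + φ ℓ_i ℓ_j = 2δ_{ij} − g^{ij}` -/

/-- The **slice metric** `g_t = δ + φ ℓ⃗ ⊗ ℓ⃗` induced by `g = η + φ ℓ ⊗ ℓ` on `{t = const}`,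
written through the smooth components as `(g_t)_{ij} = 2δ_{ij} − g^{ij}` (`g^{ij} = δ^{ij} − φ lⁱ lʲ`).
Choquet-Bruhat–Cotsakis 2002, §2, (2.1) and hypothesis (2.3) (`g_t ≥ δ`, complete).
[cite: ChoquetbruhatCotsakis2002, §2 (2.3)] -/
def sliceMetric (x : E4) (j k : Fin 3) : ℝ :=
  2 * (if j = k then 1 else 0) - B.inverseMetric x j.succ k.succ

/-- `(g_t)_{ij} = δ_{ij} + φ l_i l_j` (valid everywhere: where `φ = 0` both sides are `δ`).
[cite: ChoquetbruhatCotsakis2002, §2 (2.1)] -/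
theorem sliceMetric_eq (x : E4) (j k : Fin 3) :
    B.sliceMetric x j k = (if j = k then 1 else 0) + B.φ x * B.l x j.succ * B.l x k.succ := by
  rw [sliceMetric, B.inverseMetric_succ_succ]; ring

/-- `g_t` is symmetric. [cite: ChoquetbruhatCotsakis2002, §2 (2.1)] -/
theorem sliceMetric_symm (x : E4) (j k : Fin 3) : B.sliceMetric x j k = B.sliceMetric x k j := by
  have hδ : (if j = k then (1 : ℝ) else 0) = if k = j then 1 else 0 := by
    by_cases h : j = k
    · simp [h]
    · simp [h, Ne.symm h]
  show 2 * (if j = k then (1 : ℝ) else 0) - KerrSchild.inverseMetric B.φ B.l x j.succ k.succ =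
    2 * (if k = j then (1 : ℝ) else 0) - KerrSchild.inverseMetric B.φ B.l x k.succ j.succ
  rw [hδ, KerrSchild.inverseMetric_symm]

/-- The slice metric as a quadratic form: `(g_t)_{ij} vⁱ vʲ = |v|² + φ (ℓ⃗·v)²`.
[cite: ChoquetbruhatCotsakis2002, §2 (2.3)] -/
theorem sum_sum_sliceMetric_mul_mul (x : E4) (v : Fin 3 → ℝ) :
    ∑ j : Fin 3, ∑ k : Fin 3, B.sliceMetric x j k * v j * v k =
      ∑ k : Fin 3, v k ^ 2 + B.φ x * (∑ k : Fin 3, B.l x k.succ * v k) ^ 2 := by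
  have h := sum_sum_kronecker_sub_rankOne_mul_mul (-B.φ x) (fun k ↦ B.l x k.succ) v
  simp only [B.sliceMetric_eq]
  simp only [neg_mul, sub_neg_eq_add] at h
  rw [h]

/-- **`g_t ≥ δ`** (hypothesis (2.3) with `A = 1`: the slices are uniformly bounded below by the
complete flat metric). [cite: ChoquetbruhatCotsakis2002, §2 (2.3)] -/
theorem sum_sq_le_sum_sum_sliceMetric_mul_mul (x : E4) (v : Fin 3 → ℝ) :
    ∑ k : Fin 3, v k ^ 2 ≤ ∑ j : Fin 3, ∑ k : Fin 3, B.sliceMetric x j k * v j * v k := by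
  rw [B.sum_sum_sliceMetric_mul_mul]
  nlinarith [B.φ_nonneg x, sq_nonneg (∑ k : Fin 3, B.l x k.succ * v k)]

/-- **`g_t ≤ (1 + Φ) δ`** (`φ (ℓ⃗·v)² ≤ Φ |v|²` by Cauchy–Schwarz with `|ℓ⃗| = 1`).
[cite: ChoquetbruhatCotsakis2002, §2 (2.3)] -/
theorem sum_sum_sliceMetric_mul_mul_le (x : E4) (v : Fin 3 → ℝ) :
    ∑ j : Fin 3, ∑ k : Fin 3, B.sliceMetric x j k * v j * v k ≤
      (1 + B.bound) * ∑ k : Fin 3, v k ^ 2 := by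
  rw [B.sum_sum_sliceMetric_mul_mul]
  have h0 : 0 ≤ B.φ x := B.φ_nonneg x
  have h1 : B.φ x ≤ B.bound := B.φ_le x
  have hv : 0 ≤ ∑ k : Fin 3, v k ^ 2 := Finset.sum_nonneg fun k _ ↦ sq_nonneg _
  by_cases hx : B.φ x = 0
  · rw [hx]; nlinarith
  · have hcs : (∑ k : Fin 3, B.l x k.succ * v k) ^ 2 ≤ ∑ k : Fin 3, v k ^ 2 := by
      have h := Finset.sum_mul_sq_le_sq_mul_sq Finset.univ (fun k : Fin 3 ↦ B.l x k.succ) v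
      rwa [B.sum_sq_l_succ hx, one_mul] at h
    nlinarith [mul_le_mul_of_nonneg_left hcs h0]

/-- **`(g_t)^{ij}` and `(g_t)_{jk}` are inverse to each other**: `∑_k (g_t)^{jk} (g_t)_{kl} = δ_{jl}`
(`(δ − c ℓ⃗ℓ⃗ᵀ)(δ + φ ℓ⃗ℓ⃗ᵀ) = δ + (φ − c(1 + φ)) ℓ⃗ℓ⃗ᵀ` with `|ℓ⃗| = 1`, `c = φ/(1 + φ)`).
[cite: ChoquetbruhatCotsakis2002, §2 (2.1)] -/
theorem sum_sliceInvMetric_mul_sliceMetric (x : E4) (j l : Fin 3) :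
    ∑ k : Fin 3, B.sliceInvMetric x j k * B.sliceMetric x k l = if j = l then 1 else 0 := by
  simp only [B.sliceInvMetric_eq, B.sliceMetric_eq]
  by_cases hx : B.φ x = 0
  · simp only [hx, zero_div, zero_mul, sub_zero, add_zero]
    simp [Finset.sum_ite_eq', mul_ite]
  · have ha : 1 + B.φ x ≠ 0 := by linarith [B.φ_nonneg x]
    have hc : B.φ x / (1 + B.φ x) * (1 + B.φ x) = B.φ x := div_mul_cancel₀ _ ha
    exact sum_kronecker_sub_rankOne_mul_kronecker_add_rankOne (p := fun k ↦ B.l x k.succ) hc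
      (B.sum_sq_l_succ hx) j l

/-- The other order: `∑_k (g_t)_{jk} (g_t)^{kl} = δ_{jl}` (both matrices are symmetric).
[cite: ChoquetbruhatCotsakis2002, §2 (2.1)] -/
theorem sum_sliceMetric_mul_sliceInvMetric (x : E4) (j l : Fin 3) :
    ∑ k : Fin 3, B.sliceMetric x j k * B.sliceInvMetric x k l = if j = l then 1 else 0 := by
  have h := B.sum_sliceInvMetric_mul_sliceMetric x l j
  rw [show (if l = j then (1 : ℝ) else 0) = if j = l then 1 else 0 from by
    by_cases hjl : j = l
    · simp [hjl]
    · simp [hjl, Ne.symm hjl]] at h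
  rw [← h]
  refine Finset.sum_congr rfl fun k _ ↦ ?_
  rw [B.sliceMetric_symm x j k, B.sliceInvMetric_symm x k l]; ring

/-- The slice metric is smooth. [cite: ChoquetbruhatCotsakis2002, §2] -/
theorem contDiff_sliceMetric (j k : Fin 3) : ContDiff ℝ ∞ fun x ↦ B.sliceMetric x j k :=
  contDiff_const.sub (B.contDiff_inverseMetric j.succ k.succ)

/-! ### The Minkowski background -/

/-- For the Minkowski background: `N⁻² = 1`, `β = 0`, `(g_t)^{ij} = (g_t)_{ij} = δ`.
[cite: ChoquetbruhatCotsakis2002, §2 (2.1)] -/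
theorem invLapseSq_minkowski (x : E4) : minkowski.invLapseSq x = 1 := by
  simp [invLapseSq, minkowski]

/-- For the Minkowski background the shift vanishes. [cite: ChoquetbruhatCotsakis2002, §2 (2.1)] -/
theorem shift_minkowski (x : E4) (k : Fin 3) : minkowski.shift x k = 0 :=
  minkowski.shift_eq_zero_of_eq_zero rfl k

/-- For the Minkowski background `(g_t)^{ij} = δ^{ij}`. [cite: ChoquetbruhatCotsakis2002, §2 (2.1)] -/
theorem sliceInvMetric_minkowski (x : E4) (j k : Fin 3) :
    minkowski.sliceInvMetric x j k = if j = k then 1 else 0 := by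
  rw [minkowski.sliceInvMetric_eq]
  simp [minkowski]

end Background

end KerrSchild

end Literature.Geometry.Lorentzian

end
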